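import Summits.QuantumFields.YangMills.Theorems.BalabanUVNodesN12TowerSiteGraphConnectedBj
import HarnessLib

/-!
# BalabanUVNodes ∕ N12 — RIGIDITY AT THE FLAT DATUM, PART 1 (PRELIMINARIES): word bookkeeping (short closed words have zero net displacement), comb words inside
# a block, straight segments of constrained bonds, and the LOCAL CHAIN WORDS between the tower projections of adjacent fine sites (the quantitative twin of
# `…N12TowerSiteGraphConnectedBj` §2: a word of constrained segments with trivial holonomy and fewer than `(d+1)Lᵏ` letters per direction)

[Balaban1985Variational] = «[15]», Thm 1 p. 279 («a unique critical orbit in the space (6)»), (3)–(4) p. 278 (the group of gauge transformations `u = 1` on `𝔅_k`);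
[Balaban1988Convergent] = «[III]», (2.2) p. 255, (2.10)–(2.13) pp. 256–257; [Balaban1987RG1] (0.1)–(0.4), (0.11) pp. 251–253; [Balaban1985Averaging] (8), (11) pp. 18–19;
[Balaban1984PropagatorsI] (1.7) p. 18 (the comb `Γ_{y,x}`); I. Montvay, G. Münster, *Quantum fields on a lattice* (1994) (3.124)–(3.125) (a flat lattice connection with trivial
holonomies is pure gauge) [MontvayMunster1994].

Cell `pub-ymgap` (HUMAN RULINGS D-0062 ∕ D-0149), WIDTH SEAT `pub-ymgap-dag-n12-w6` g17 (node N12 = [B15]; key K1⁹ `stmt-QuantumFields-27364`, `--kind proof --supports … --as helper`;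
count-neutral; lane word n12-c g26 «GO, WANTED» I.28810).  THEOREMS ONLY (0 `def`, 0 `instance`, 0 `sorry`).  Consumed BY NAME: the word calculus of `T4Continuum` ∕ `T4ReflectionCone`
(`walk`, `walkEnd`, `holAt`, `netDisp`, `wordRev`, `holAt_walk_wordRev`, `netDisp_append`, `netDisp_replicate`), UST's `Prop7FlatHolonomy.holAt_walk_append` and
`Prop7AxialGaugeFace.netDisp_treeWord` (the comb of [Balaban1984PropagatorsI] (1.7)), dag-n12-w3's `N12BlockChains` (`exists_blockWalk_centre`, `embIter_walkEnd`,
`embIter_(un)shift_eq_walkEnd`), dag-n21-e's `N21ReadSetSupport.within_lift_of_blockIter_eq`, and this seat's `…N12TowerSiteGraphConnectedBjPrelim` (levels, the collar,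
`mem_Bj_of_blockOf_eq_outerBlock`).

WHY.  PART 2 (`…N12FlatDatumRigidity`) proves the GAUGE HALF OF [15] THM 1's UNIQUENESS AT THE FLAT DATUM for the record's determining set `𝐁_k(Z) = Bj M₁ Z k`: a HOLONOMY-FLAT
configuration `U` of the finest torus (trivial holonomy along every word of zero net displacement — UST `Prop7FlatHolonomy`'s currency, = trivial plaquettes on `SU(N)`) whose straight
transporters along the constrained bonds are trivial (`U(ι_j c₋ → Lʲ e_c) = 1` for `c ∈ bondsOf (𝐁 j)`, `j ≤ k` — what the (2.12) constraint `M˙(U) = M˙(1)` says for a flat `U`,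
UST `iter_blockAvg_eq_straightIter_of_flat`) is `1^{u}` for a gauge transformation `u` EQUAL TO `1` AT EVERY TOWER SITE — the A2 inhabitant of the (T1@q₀)-central row of the (J0′)
producer of record (dag-n12-c V4 p722394 :173–:176, U2 p724662, U3 p725063) at the flat base field.  The proof runs through LOCAL CLOSED WORDS: the comb from the tower projection `τ x`
to `x`, the bond `⟨x, x + e_μ⟩`, the reversed comb of `x + e_μ`, and a chain of constrained segments from `τ(x + e_μ)` back to `τ x`; this part supplies the pieces and their letter
counts, so that PART 2 can show such a word has fewer letters per direction than the torus has sites (`(d+3)Lᵏ ≤ 2L^{m+K}`) and therefore ZERO net displacement — no global winding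
analysis is needed.

CONTENTS (namespace `Summit.QuantumFields.YangMills.BalabanUVNodes.N12FlatDatumRigidityPrelim`; generic `P : Params`, generic `GaugeGroup G`).  §1 words: `natAbs_netDisp_le_length`,
`natAbs_netDisp_flatten_replicate_le`, ★ `netDisp_eq_zero_of_walkEnd_eq` (a closed word with fewer letters per direction than sites has zero net displacement); §2 combs:
`walkEnd_treeWord_liftSub`, `natAbs_netDisp_treeWord_liftSub_le`, `treeWord_liftSub_self`; §3 segments: `holAt_walk_replicate_false_eq_one`, ★ `holAt_walk_segments_eq_one` (a chain of
straight segments of level-`i` bonds, each trivial, is trivial); §4 ★★ `exists_chainWord_same` ∕ `_up` ∕ `_down` ∕ ★★ `exists_chainWord_of_shift` (for adjacent fine sites with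
levels `j`, `j'`: a word from `ι_j B^j(x)` to `ι_{j'} B^{j'}(x + e_μ)` of trivial holonomy under the segment letter, with `≤ (d+1)Lᵏ` net letters per direction).

HONEST FRAMING.  Lattice bookkeeping by name over landed kernel theorems; nothing of Bałaban's estimates asserted or refuted; count-neutral helper; N12 NOT discharged; K1⁹ NOT closed; counts of
record unmoved; one finite 𝕋⁴ programme at fixed ε — R4 closes the conditional rung `BalabanLadder.UV` only; the Yang–Mills mass gap (Clay) is NOT proved by any of this; nothing
continuum ∕ ℝ⁴ ∕ OS.
-/

namespace Summit.QuantumFields.YangMills.BalabanUVNodes.N12FlatDatumRigidityPrelim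

open Set
open Literature.MathematicalPhysics.QuantumFieldTheory.Balaban1983to89
open B15DeterminingSets (DetSet pts mem_pts bondsOf embIter)
open B14.Eq213DetSet (Bj maxDomT isBlockUnion_maxDomT)
open B14.Eq213MaximalDomains (side)
open B14.Eq22Determines (blockIter blockIter_zero blockIter_succ IsBlockUnion)
open B15Eq112TorusCover (cover lift cover_lift)
open B14DomainGeom (Within)
open T4Continuum (walk walkEnd holAt netDisp Letter wordRev walk_append walkEnd_append holAt_append holAt_walk_wordRev wordRev_replicate
  netDisp_wordRev holAt_nil holAt_cons netDisp_cons walkEnd_apply walkEnd_walkEnd_wordRev)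
open T4ReflectionCone (netDisp_append netDisp_replicate)
open B7Prop1Explicit (treeWord treeWord_zero)
open Summit.QuantumFields.YangMills.Theorems.Prop7FlatHolonomy (holAt_walk_append holAt_walk_single_true)
open Summit.QuantumFields.YangMills.Theorems.Prop7AxialGaugeFace (netDisp_treeWord)
open Summit.QuantumFields.YangMills.BalabanUVNodes.N12BlockChains (blockOf_shift_or exists_blockWalk_centre embIter_walkEnd embIter_shift_eq_walkEnd
  embIter_unshift_eq_walkEnd)
open Summit.QuantumFields.YangMills.Theorems.N21ReadSetSupport (within_lift_of_blockIter_eq blockIter_embIter)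
open Summit.QuantumFields.YangMills.BalabanUVNodes.N12TowerSiteGraphConnectedBjPrelim

variable {P : Params} {G : Type*} [GaugeGroup G] {M₁ k : ℕ} {Z : Set (Site P 0)}

/-! ## §1  Words: letter counts and the zero net displacement of short closed words -/

/-- A word moves each coordinate by at most its length: `|netDisp w ν| ≤ |w|` (in `ℕ`). [folklore] -/
theorem natAbs_netDisp_le_length {n : ℕ} : ∀ (w : List (Letter n)) (ν : Fin n), (netDisp w ν).natAbs ≤ w.length
  | [], ν => by simp [netDisp]
  | l :: w, ν => by
    rw [netDisp_cons, List.length_cons]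
    have ih := natAbs_netDisp_le_length w ν
    have h1 : (if l.1 = ν then (if l.2 then (1 : ℤ) else -1) else 0).natAbs ≤ 1 := by split_ifs <;> simp
    calc _ ≤ (if l.1 = ν then (if l.2 then (1 : ℤ) else -1) else 0).natAbs + (netDisp w ν).natAbs := Int.natAbs_add_le _ _
      _ ≤ 1 + w.length := add_le_add h1 ih
      _ = w.length + 1 := add_comm _ _

/-- The `n`-fold dilation of a word moves each coordinate by at most `n·|w|`. [folklore] -/
theorem natAbs_netDisp_flatten_replicate_le {d : ℕ} (n : ℕ) : ∀ (w : List (Letter d)) (ν : Fin d),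
    (netDisp ((w.map fun l => List.replicate n l).flatten) ν).natAbs ≤ n * w.length
  | [], ν => by simp [netDisp]
  | l :: w, ν => by
    rw [List.map_cons, List.flatten_cons, netDisp_append, List.length_cons, Nat.mul_succ]
    have ih := natAbs_netDisp_flatten_replicate_le n w ν
    have h1 : (netDisp (List.replicate n l) ν).natAbs ≤ n := by
      rw [netDisp_replicate]
      split_ifs <;> simp
    calc _ ≤ (netDisp (List.replicate n l) ν).natAbs + (netDisp ((w.map fun l => List.replicate n l).flatten) ν).natAbs := Int.natAbs_add_le _ _
      _ ≤ n + n * w.length := add_le_add h1 ih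
      _ = n * w.length + n := add_comm _ _

/-- ★ **A CLOSED WORD WITH FEWER NET LETTERS PER DIRECTION THAN THE TORUS HAS SITES HAS ZERO NET DISPLACEMENT**: `walkEnd x w = x` forces `N ∣ netDisp w ν` (`walkEnd_apply`), and
`|netDisp w ν| < N` leaves `0`. [cite: Balaban1987RG1, (0.1) p.251 (the torus; bookkeeping)] -/
theorem netDisp_eq_zero_of_walkEnd_eq {j : ℕ} {x : Site P j} {w : List (Letter P.d)} (hx : walkEnd x w = x)
    (hsmall : ∀ ν, (netDisp w ν).natAbs < P.sitesPerDir j) (ν : Fin P.d) : netDisp w ν = 0 := by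
  have h := congrFun hx ν
  rw [walkEnd_apply] at h
  have h0 : ((netDisp w ν : ℤ) : ZMod (P.sitesPerDir j)) = 0 := add_eq_left.mp h
  have hdvd : ((P.sitesPerDir j : ℕ) : ℤ) ∣ netDisp w ν := (ZMod.intCast_zmod_eq_zero_iff_dvd _ _).mp h0
  exact Int.eq_zero_of_dvd_of_natAbs_lt_natAbs hdvd (by simpa using hsmall ν)

/-! ## §2  Combs inside a block: the word from the tower projection `ι_ℓ B^ℓ(x)` to `x` -/

/-- The comb of the integer vector `lift x − lift e` ([Balaban1984PropagatorsI]'s `Γ_{e,x}` read with the standard lifts) ends at `x`. [cite: Balaban1984PropagatorsI, (1.7) p.18] -/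
theorem walkEnd_treeWord_liftSub (e x : Site P 0) :
    walkEnd e (treeWord (fun ν => lift P x ν - lift P e ν)) = x := by
  funext ν
  rw [walkEnd_apply, netDisp_treeWord]
  simp [lift]

/-- Its net letter count per direction is the lift difference, at most `L^ℓ − 1` when `e` and `x` share their `ℓ`-block (`ℓ ≤ m + K`; dag-n21-e's `within_lift_of_blockIter_eq`).
[cite: Balaban1984PropagatorsI, (1.7) p.18; Balaban1987RG1, (0.1) p.251] -/
theorem natAbs_netDisp_treeWord_liftSub_le {ℓ : ℕ} (hℓ : ℓ ≤ P.m + P.K) {e x : Site P 0} (h : blockIter ℓ e = blockIter ℓ x) (ν : Fin P.d) :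
    (netDisp (treeWord (fun ν => lift P x ν - lift P e ν)) ν).natAbs ≤ P.L ^ ℓ - 1 := by
  rw [netDisp_treeWord]
  have hw := within_lift_of_blockIter_eq hℓ h ν
  have h1 : 1 ≤ P.L ^ ℓ := Nat.one_le_pow _ _ P.L_pos
  have h2 : ((lift P x ν - lift P e ν).natAbs : ℤ) ≤ ((P.L ^ ℓ : ℕ) : ℤ) - 1 := by
    rw [Int.natCast_natAbs, abs_sub_comm]; exact hw
  omega

/-- The comb from a site to itself is the empty word (`treeWord 0 = []`). [cite: Balaban1984PropagatorsI, (1.7) p.18 (bookkeeping)] -/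
theorem treeWord_liftSub_self (x : Site P 0) : treeWord (fun ν => lift P x ν - lift P x ν) = ([] : List (Letter P.d)) := by
  have h : (fun ν => lift P x ν - lift P x ν) = (0 : B7Prop1Explicit.Site P.d) := by funext ν; simp
  rw [h, treeWord_zero]

/-! ## §3  Straight segments of constrained bonds -/

/-- The backward straight segment of a level-`i` bond is trivial when the forward one is (`U(−Γ) = U(Γ)⁻¹`). [cite: Balaban1984PropagatorsI, (1.7) p.18] -/
theorem holAt_walk_replicate_false_eq_one {i : ℕ} (U : GaugeField P 0 G) (c : PBond P i)
    (h : holAt U (walk (embIter i c.src) (List.replicate (P.L ^ i) (c.dir, true))) = 1) :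
    holAt U (walk (embIter i c.tgt) (List.replicate (P.L ^ i) (c.dir, false))) = 1 := by
  have e : embIter i c.tgt = walkEnd (embIter i c.src) (List.replicate (P.L ^ i) (c.dir, true)) := embIter_shift_eq_walkEnd i c.src c.dir
  have hrev : wordRev (List.replicate (P.L ^ i) ((c.dir, true) : Letter P.d)) = List.replicate (P.L ^ i) (c.dir, false) := by
    rw [wordRev_replicate]; rfl
  rw [e, ← hrev, holAt_walk_wordRev, h, inv_one]

/-- ★ **A CHAIN OF STRAIGHT SEGMENTS IS TRIVIAL WHEN EACH SEGMENT IS**: for a list `ch` of oriented level-`i` bonds spelling a walk from `q` (each link read at its start, dag-n12-w3's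
`ch = pre ++ l :: post` addressing), if every forward segment `U(ι_i c₋ → Lⁱ e_c)` of a bond of `ch` is `1`, then the holonomy of `U` along the concatenated fine segments from `ι_i q` is `1`.
[cite: Balaban1987RG1, (0.1) p.251 (bookkeeping); Balaban1984PropagatorsI, (1.7) p.18] -/
theorem holAt_walk_segments_eq_one {i : ℕ} (U : GaugeField P 0 G) :
    ∀ (ch : List (PBond P i × Bool)) (q : Site P i),
      (∀ l ∈ ch, holAt U (walk (embIter i l.1.src) (List.replicate (P.L ^ i) (l.1.dir, true))) = 1) →
      (∀ (pre post : List (PBond P i × Bool)) (l : PBond P i × Bool), ch = pre ++ l :: post →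
        (l.2 = true → walkEnd q (pre.map fun l => (l.1.dir, l.2)) = l.1.src) ∧
        (l.2 = false → walkEnd q (pre.map fun l => (l.1.dir, l.2)) = l.1.tgt)) →
      holAt U (walk (embIter i q) ((ch.map fun l => List.replicate (P.L ^ i) (l.1.dir, l.2)).flatten)) = 1
  | [], q, _, _ => by simp [walk, holAt_nil]
  | (b, s) :: ch, q, hseg, hread => by
    have h0 := hread [] ch (b, s) rfl
    rw [List.map_cons, List.flatten_cons, holAt_walk_append]
    -- the tail, read from the site after the first link
    have htail : ∀ q₁ : Site P i, walkEnd q [(b.dir, s)] = q₁ →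
        holAt U (walk (embIter i q₁) ((ch.map fun l => List.replicate (P.L ^ i) (l.1.dir, l.2)).flatten)) = 1 := by
      intro q₁ hq₁
      refine holAt_walk_segments_eq_one U ch q₁ (fun l hl => hseg l (List.mem_cons_of_mem _ hl)) (fun pre post l hch => ?_)
      have h := hread ((b, s) :: pre) post l (by rw [hch]; rfl)
      rw [List.map_cons] at h
      have e : ∀ rest : List (Letter P.d), walkEnd q ((b.dir, s) :: rest) = walkEnd q₁ rest := fun rest => by
        rw [← hq₁]; cases s <;> rfl
      rw [e] at h
      exact h
    cases s
    · -- backward link: `q = b₊`, the segment `(dir, false)^{Lⁱ}` from `ι_i b₊` ends at `ι_i b₋`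
      have hq : q = b.tgt := h0.2 rfl
      subst hq
      have hend : walkEnd (embIter i b.tgt) (List.replicate (P.L ^ i) (b.dir, false)) = embIter i b.src := by
        rw [← embIter_unshift_eq_walkEnd]
        show embIter i ((b.src.shift b.dir).unshift b.dir) = embIter i b.src
        rw [B10StarCount.unshift_shift]
      rw [hend, holAt_walk_replicate_false_eq_one U b (hseg (b, false) List.mem_cons_self), one_mul]
      exact htail b.src (by show (b.src.shift b.dir).unshift b.dir = b.src; exact B10StarCount.unshift_shift _ _)
    · -- forward link: `q = b₋`
      have hq : q = b.src := h0.1 rfl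
      subst hq
      have hend : walkEnd (embIter i b.src) (List.replicate (P.L ^ i) (b.dir, true)) = embIter i b.tgt :=
        (embIter_shift_eq_walkEnd i b.src b.dir).symm
      rw [hend, hseg (b, true) List.mem_cons_self, one_mul]
      exact htail b.tgt rfl

/-- The fine reading of a level-`i` walk: the concatenated segments from `ι_i q` end at `ι_i` of the walk's end (dag-n12-w3's `embIter_walkEnd`). [cite: Balaban1987RG1, (0.1) p.251 (bookkeeping)] -/
theorem walkEnd_segments {i : ℕ} (ch : List (PBond P i × Bool)) (q : Site P i) :
    walkEnd (embIter i q) ((ch.map fun l => List.replicate (P.L ^ i) (l.1.dir, l.2)).flatten) = embIter i (walkEnd q (ch.map fun l => (l.1.dir, l.2))) := by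
  have e : (ch.map fun l => List.replicate (P.L ^ i) (l.1.dir, l.2)) = ((ch.map fun l => (l.1.dir, l.2)).map fun l => List.replicate (P.L ^ i) l) := by
    rw [List.map_map]; rfl
  rw [e, ← embIter_walkEnd]

/-- Letter count of the concatenated segments: `≤ Lⁱ·|ch|` per direction. [folklore] -/
theorem natAbs_netDisp_segments_le {i : ℕ} (ch : List (PBond P i × Bool)) (ν : Fin P.d) :
    (netDisp ((ch.map fun l => List.replicate (P.L ^ i) (l.1.dir, l.2)).flatten) ν).natAbs ≤ P.L ^ i * ch.length := by
  have e : (ch.map fun l => List.replicate (P.L ^ i) (l.1.dir, l.2)) = ((ch.map fun l => (l.1.dir, l.2)).map fun l => List.replicate (P.L ^ i) l) := by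
    rw [List.map_map]; rfl
  rw [e]
  have h := natAbs_netDisp_flatten_replicate_le (P.L ^ i) (ch.map fun l => (l.1.dir, l.2)) ν
  rwa [List.length_map] at h

/-! ## §4  The local chain words between the tower projections of adjacent fine sites -/

/-- Arithmetic of the letter budget: an in-block walk of `≤ d·(L−1)∕2` level-`j` links plus one level-`(j+1)` segment costs `≤ (d+1)Lᵏ` letters per direction (`j + 1 ≤ k`). [folklore] -/
theorem segments_budget_le {j n : ℕ} (hj : j + 1 ≤ k) (hn : n ≤ P.d * ((P.L - 1) / 2)) :
    P.L ^ j * n + P.L ^ (j + 1) ≤ (P.d + 1) * P.L ^ k := by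
  have hL := P.L_pos
  have h1 : (P.L - 1) / 2 ≤ P.L := le_trans (Nat.div_le_self _ _) (Nat.sub_le _ _)
  have h2 : n ≤ P.d * P.L := le_trans hn (Nat.mul_le_mul_left _ h1)
  have h3 : P.L ^ (j + 1) ≤ P.L ^ k := Nat.pow_le_pow_right hL hj
  calc P.L ^ j * n + P.L ^ (j + 1) ≤ P.L ^ j * (P.d * P.L) + P.L ^ (j + 1) := by
        have := Nat.mul_le_mul_left (P.L ^ j) h2; omega
    _ = (P.d + 1) * P.L ^ (j + 1) := by rw [pow_succ]; ring
    _ ≤ (P.d + 1) * P.L ^ k := Nat.mul_le_mul_left _ h3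

/-- ★★ **SAME LEVEL**: if the `j`-block of `x` is a `Γ_j`-site, a word from `ι_j B^j(x)` to `ι_j B^j(x + e_μ)` of trivial holonomy with `≤ (d+1)Lᵏ` net letters per direction: the empty
word, or the straight segment of the constrained bond `⟨B^j(x), μ⟩`. [cite: Balaban1988Convergent, (2.2) p.255, (2.10)–(2.12) p.256; Balaban1984PropagatorsI, (1.7) p.18] -/
theorem exists_chainWord_same (hk : k ≤ P.m + P.K) {U : GaugeField P 0 G}
    (hseg : ∀ j, j ≤ k → ∀ c ∈ bondsOf (Bj M₁ Z k j), holAt U (walk (embIter j c.src) (List.replicate (P.L ^ j) (c.dir, true))) = 1)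
    {x : Site P 0} {μ : Fin P.d} {j : ℕ} (hj : j ≤ k) (h : blockIter j x ∈ Bj M₁ Z k j) :
    ∃ ω : List (Letter P.d), walkEnd (embIter j (blockIter j x)) ω = embIter j (blockIter j (x.shift μ)) ∧
      holAt U (walk (embIter j (blockIter j x)) ω) = 1 ∧ ∀ ν, (netDisp ω ν).natAbs ≤ (P.d + 1) * P.L ^ k := by
  rcases blockIter_shift_or (hj.trans hk) x μ with e | e
  · exact ⟨[], by rw [e]; rfl, by simp [walk, holAt_nil], fun ν => by simp [netDisp]⟩
  · have hb : P.L ^ j ≤ (P.d + 1) * P.L ^ k :=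
      le_trans (Nat.pow_le_pow_right P.L_pos hj) (Nat.le_mul_of_pos_left _ (Nat.succ_pos _))
    refine ⟨List.replicate (P.L ^ j) (μ, true), ?_, hseg j hj ⟨blockIter j x, μ⟩ (Or.inl h), fun ν => ?_⟩
    · rw [e]; exact (embIter_shift_eq_walkEnd j _ μ).symm
    · rw [netDisp_replicate]
      split_ifs <;> simp [hb]

/-- ★★ **ONE LEVEL UP** (`x` of level `j`, `x + e_μ` of level `j + 1 ≤ k`): a word from `ι_j B^j(x)` to `ι_{j+1} B^{j+1}(x + e_μ)` of trivial holonomy with `≤ (d+1)Lᵏ` net letters per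
direction — dag-n12-w3's in-block walk from `B^j(x)` to the centre of the outer block `w = B^{j+1}(x)` (all its links constrained level-`j` bonds: `mem_Bj_of_blockOf_eq_outerBlock`), read as
straight segments, followed by the straight segment of the constrained `(j+1)`-bond `⟨w, μ⟩`. [cite: Balaban1988Convergent, (2.2) p.255, (2.13) pp.256–257; Balaban1984PropagatorsI, (1.7) p.18] -/
theorem exists_chainWord_up (hM : 2 ≤ M₁) (hk1 : 1 ≤ k) (hk : k ≤ P.m + P.K) (hdiv : side P.L M₁ k ∣ P.sitesPerDir 0) {U : GaugeField P 0 G}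
    (hseg : ∀ j, j ≤ k → ∀ c ∈ bondsOf (Bj M₁ Z k j), holAt U (walk (embIter j c.src) (List.replicate (P.L ^ j) (c.dir, true))) = 1)
    {x : Site P 0} {μ : Fin P.d} {j : ℕ} (hj : j + 1 ≤ k)
    (h : blockIter j x ∈ Bj M₁ Z k j) (h' : blockIter (j + 1) (x.shift μ) ∈ Bj M₁ Z k (j + 1)) :
    ∃ ω : List (Letter P.d), walkEnd (embIter j (blockIter j x)) ω = embIter (j + 1) (blockIter (j + 1) (x.shift μ)) ∧
      holAt U (walk (embIter j (blockIter j x)) ω) = 1 ∧ ∀ ν, (netDisp ω ν).natAbs ≤ (P.d + 1) * P.L ^ k := by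
  have hM1 : 1 ≤ M₁ := one_le_of_two_le hM
  have hx : x ∉ maxDomT M₁ Z (j + 1) := not_mem_maxDomT_succ_of_level hM1 hk hdiv (by omega) h
  have hx' : x.shift μ ∈ maxDomT M₁ Z (j + 1) := mem_maxDomT_of_level hM1 hk hdiv (by omega) hj h'
  rcases blockIter_shift_or (show j + 1 ≤ P.m + P.K by omega) x μ with e | e
  · exfalso
    have hBU := isBlockUnion_maxDomT hM1 hdiv (show 1 ≤ j + 1 by omega) hj (show j + 1 ≤ P.m + P.K by omega) (Ω := Z)
    have h1 := (hBU (x.shift μ)).1 hx'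
    rw [e] at h1
    exact hx ((hBU x).2 h1)
  · -- the in-block walk from `B^j(x)` to the centre `emb w` of `w = B^{j+1}(x)`
    obtain ⟨ch, hlen, hmem, hend, hcons⟩ := exists_blockWalk_centre (show j + 1 ≤ P.m + P.K by omega) (blockIter j x) (emb (blockIter (j + 1) x))
      (blockIter (j + 1) x) (blockIter_succ j x).symm (Site.blockOf_emb (by omega) _) (Or.inr rfl)
    have hchseg : ∀ l ∈ ch, holAt U (walk (embIter j l.1.src) (List.replicate (P.L ^ j) (l.1.dir, true))) = 1 := fun l hl =>
      hseg j (by omega) l.1 (Or.inl (mem_Bj_of_blockOf_eq_outerBlock hM hk1 hk hdiv hj (Or.inl rfl) hx' hx (hmem l hl).1))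
    -- its fine reading ends at `ι_j (emb w) = ι_{j+1} w`
    have e1 : walkEnd (embIter j (blockIter j x)) ((ch.map fun l => List.replicate (P.L ^ j) (l.1.dir, l.2)).flatten) = embIter (j + 1) (blockIter (j + 1) x) := by
      rw [walkEnd_segments, hend]; rfl
    -- the constrained `(j+1)`-bond `⟨w, μ⟩` (its target is the `Γ_{j+1}`-site `B^{j+1}(x + e_μ)`)
    have hc : (⟨blockIter (j + 1) x, μ⟩ : PBond P (j + 1)) ∈ bondsOf (Bj M₁ Z k (j + 1)) := by
      refine Or.inr ?_
      show (blockIter (j + 1) x).shift μ ∈ Bj M₁ Z k (j + 1)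
      rw [← e]; exact h'
    refine ⟨(ch.map fun l => List.replicate (P.L ^ j) (l.1.dir, l.2)).flatten ++ List.replicate (P.L ^ (j + 1)) (μ, true), ?_, ?_, fun ν => ?_⟩
    · rw [walkEnd_append, e1, e]
      exact (embIter_shift_eq_walkEnd (j + 1) _ μ).symm
    · have hs := hseg (j + 1) hj _ hc
      rw [holAt_walk_append, holAt_walk_segments_eq_one U ch _ hchseg hcons, one_mul, e1]
      exact hs
    · rw [netDisp_append]
      have h1 := natAbs_netDisp_segments_le ch ν (i := j)
      have h2 : (netDisp (List.replicate (P.L ^ (j + 1)) ((μ, true) : Letter P.d)) ν).natAbs ≤ P.L ^ (j + 1) := by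
        rw [netDisp_replicate]; split_ifs <;> simp
      calc _ ≤ _ + _ := Int.natAbs_add_le _ _
        _ ≤ P.L ^ j * ch.length + P.L ^ (j + 1) := add_le_add h1 h2
        _ ≤ (P.d + 1) * P.L ^ k := segments_budget_le hj hlen

/-- ★★ **ONE LEVEL DOWN** (`x` of level `j + 1 ≤ k`, `x + e_μ` of level `j`): a word from `ι_{j+1} B^{j+1}(x)` to `ι_j B^j(x + e_μ)` of trivial holonomy with `≤ (d+1)Lᵏ` net letters
per direction — the straight segment of the constrained `(j+1)`-bond `⟨B^{j+1}(x), μ⟩` to the centre of the outer block `w' = B^{j+1}(x + e_μ)`, then dag-n12-w3's in-block walk from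
that centre to `B^j(x + e_μ)`. [cite: Balaban1988Convergent, (2.2) p.255, (2.13) pp.256–257; Balaban1984PropagatorsI, (1.7) p.18] -/
theorem exists_chainWord_down (hM : 2 ≤ M₁) (hk1 : 1 ≤ k) (hk : k ≤ P.m + P.K) (hdiv : side P.L M₁ k ∣ P.sitesPerDir 0) {U : GaugeField P 0 G}
    (hseg : ∀ j, j ≤ k → ∀ c ∈ bondsOf (Bj M₁ Z k j), holAt U (walk (embIter j c.src) (List.replicate (P.L ^ j) (c.dir, true))) = 1)
    {x : Site P 0} {μ : Fin P.d} {j : ℕ} (hj : j + 1 ≤ k)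
    (h : blockIter (j + 1) x ∈ Bj M₁ Z k (j + 1)) (h' : blockIter j (x.shift μ) ∈ Bj M₁ Z k j) :
    ∃ ω : List (Letter P.d), walkEnd (embIter (j + 1) (blockIter (j + 1) x)) ω = embIter j (blockIter j (x.shift μ)) ∧
      holAt U (walk (embIter (j + 1) (blockIter (j + 1) x)) ω) = 1 ∧ ∀ ν, (netDisp ω ν).natAbs ≤ (P.d + 1) * P.L ^ k := by
  have hM1 : 1 ≤ M₁ := one_le_of_two_le hM
  have hx : x ∈ maxDomT M₁ Z (j + 1) := mem_maxDomT_of_level hM1 hk hdiv (by omega) hj h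
  have hx' : x.shift μ ∉ maxDomT M₁ Z (j + 1) := not_mem_maxDomT_succ_of_level hM1 hk hdiv (by omega) h'
  rcases blockIter_shift_or (show j + 1 ≤ P.m + P.K by omega) x μ with e | e
  · exfalso
    have hBU := isBlockUnion_maxDomT hM1 hdiv (show 1 ≤ j + 1 by omega) hj (show j + 1 ≤ P.m + P.K by omega) (Ω := Z)
    have h1 := (hBU x).1 hx
    rw [← e] at h1
    exact hx' ((hBU (x.shift μ)).2 h1)
  · -- the in-block walk from the centre of `w' = B^{j+1}(x + e_μ)` to `B^j(x + e_μ)`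
    obtain ⟨ch, hlen, hmem, hend, hcons⟩ := exists_blockWalk_centre (show j + 1 ≤ P.m + P.K by omega) (emb (blockIter (j + 1) (x.shift μ)))
      (blockIter j (x.shift μ)) (blockIter (j + 1) (x.shift μ)) (Site.blockOf_emb (by omega) _) (blockIter_succ j (x.shift μ)).symm (Or.inl rfl)
    have hchseg : ∀ l ∈ ch, holAt U (walk (embIter j l.1.src) (List.replicate (P.L ^ j) (l.1.dir, true))) = 1 := fun l hl =>
      hseg j (by omega) l.1 (Or.inl (mem_Bj_of_blockOf_eq_outerBlock hM hk1 hk hdiv hj (Or.inr rfl) hx hx' (hmem l hl).1))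
    -- the constrained `(j+1)`-bond `⟨B^{j+1}(x), μ⟩`, sourced in `Γ_{j+1}`; its segment ends at `ι_{j+1} w' = ι_j (emb w')`
    have hc : (⟨blockIter (j + 1) x, μ⟩ : PBond P (j + 1)) ∈ bondsOf (Bj M₁ Z k (j + 1)) := Or.inl h
    have e1 : walkEnd (embIter (j + 1) (blockIter (j + 1) x)) (List.replicate (P.L ^ (j + 1)) (μ, true)) = embIter j (emb (blockIter (j + 1) (x.shift μ))) := by
      rw [← embIter_shift_eq_walkEnd, ← e]; rfl
    refine ⟨List.replicate (P.L ^ (j + 1)) (μ, true) ++ (ch.map fun l => List.replicate (P.L ^ j) (l.1.dir, l.2)).flatten, ?_, ?_, fun ν => ?_⟩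
    · rw [walkEnd_append, e1, walkEnd_segments, hend]
    · rw [holAt_walk_append, hseg (j + 1) hj _ hc, one_mul, e1]
      exact holAt_walk_segments_eq_one U ch _ hchseg hcons
    · rw [netDisp_append]
      have h1 := natAbs_netDisp_segments_le ch ν (i := j)
      have h2 : (netDisp (List.replicate (P.L ^ (j + 1)) ((μ, true) : Letter P.d)) ν).natAbs ≤ P.L ^ (j + 1) := by
        rw [netDisp_replicate]; split_ifs <;> simp
      calc _ ≤ _ + _ := Int.natAbs_add_le _ _
        _ ≤ P.L ^ (j + 1) + P.L ^ j * ch.length := add_le_add h2 h1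
        _ = P.L ^ j * ch.length + P.L ^ (j + 1) := add_comm _ _
        _ ≤ (P.d + 1) * P.L ^ k := segments_budget_le hj hlen

/-- ★★ **THE LOCAL CHAIN WORD OF A FINE BOND**: for `x` whose `j`-block is a `Γ_j`-site and `x + e_μ` whose `j'`-block is a `Γ_{j'}`-site (`j, j' ≤ k`; the levels are at most one apart,
`levels_near_of_shift`), a word from `ι_j B^j(x)` to `ι_{j'} B^{j'}(x + e_μ)` of trivial holonomy under the segment letter, with `≤ (d+1)Lᵏ` net letters per direction.
[cite: Balaban1988Convergent, (2.2) p.255, (2.13) pp.256–257; Balaban1984PropagatorsI, (1.7) p.18] -/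
theorem exists_chainWord_of_shift (hM : 2 ≤ M₁) (hk1 : 1 ≤ k) (hk : k ≤ P.m + P.K) (hdiv : side P.L M₁ k ∣ P.sitesPerDir 0) {U : GaugeField P 0 G}
    (hseg : ∀ j, j ≤ k → ∀ c ∈ bondsOf (Bj M₁ Z k j), holAt U (walk (embIter j c.src) (List.replicate (P.L ^ j) (c.dir, true))) = 1)
    (x : Site P 0) (μ : Fin P.d) {j j' : ℕ} (hj : j ≤ k) (hj' : j' ≤ k)
    (h : blockIter j x ∈ Bj M₁ Z k j) (h' : blockIter j' (x.shift μ) ∈ Bj M₁ Z k j') :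
    ∃ ω : List (Letter P.d), walkEnd (embIter j (blockIter j x)) ω = embIter j' (blockIter j' (x.shift μ)) ∧
      holAt U (walk (embIter j (blockIter j x)) ω) = 1 ∧ ∀ ν, (netDisp ω ν).natAbs ≤ (P.d + 1) * P.L ^ k := by
  obtain ⟨h1, h2⟩ := levels_near_of_shift hM hk hdiv hj hj' h h'
  rcases lt_trichotomy j j' with hlt | rfl | hgt
  · obtain rfl : j' = j + 1 := by omega
    exact exists_chainWord_up hM hk1 hk hdiv hseg hj' h h'
  · exact exists_chainWord_same hk hseg hj h
  · obtain rfl : j = j' + 1 := by omega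
    exact exists_chainWord_down hM hk1 hk hdiv hseg hj h h'

end Summit.QuantumFields.YangMills.BalabanUVNodes.N12FlatDatumRigidityPrelim
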